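import Mathlib
import Summits.Ventures.HodgeRepro.PeriodCloserC7Doubling

/-!
# PeriodCloserC7CupProduct — the cup product (D2) from Bergeron's pointwise identity of theta forms, and the
doubling form of the identification from its kernel-level inputs

Blind re-derivation cell `pub-hodge-repro`, seat night-2 (gen 2).  Target tree path
`lean/Summits/Ventures/HodgeRepro/PeriodCloserC7CupProduct.lean`.

Component (D2) of `PeriodCloserC7Identification.lean` — `CupProduct`: the wedge of the two line lifts of a plane
is the plane lift — rests on ONE printed pointwise identity: Bergeron 2006 (paper:arxiv-math_0612447) Théorème 1.1,
p0003:L30–L33 VERBATIM «Les formes sont compatibles avec le cup-produit :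
`φ^{(r_1 q, s_1 q)} ∧ φ^{(r_2 q, s_2 q)} = φ^{((r_1 + r_2) q, (s_1 + s_2) q)}`» — for the pair `(U(1), U(V))` of a line the
Schwartz form is the `(q, 0)`-form `φ^{(q,0)}`, `q = 1`, and for the plane `W^{(i)} = W_{2i} ⊕ W_{2i+1}` the theta kernel
at `(g_0, g_1) ∈ U(W_{2i}) × U(W_{2i+1})` is the wedge of the two line kernels (the Weil representation of the plane
restricted to the product of the two line groups is the tensor product of the line representations: Kudla,
*Notes*, IV.1 Example 1.2 p0043:L21–29).  The rest is bilinearity of the wedge and the product structure of the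
torus integral `∫_{[T_i]} = ∫_{[U(W_{2i})]} ∫_{[U(W_{2i+1})]}`.  This file states these as a line-level interface
(`LineInterface`, `LineComponents`) and PROVES (D2) at the level of coefficient functions
(`LineComponents.cupProduct_coeff`); since the Hodge pairing only sees coefficient functions (`hodge_def`), the
doubling form of the identification then follows from the kernel-level inputs alone
(`doubling_of_kernel`: (D0), (D1), Bergeron's identity, Harris's product formula, Siegel–Weil, the definitional
matches and the integration rules), without the form-level (D2).  Nothing here says anything about the status of
the Hodge conjecture for CM abelian varieties, which is NOT proved.
-/

set_option autoImplicit false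

noncomputable section

namespace Summit.Ventures.HodgeRepro.PeriodCloser

open NumberField

variable {L : Type} [Field L] [NumberField L] [IsCMField L]

/-- The coefficient of the wedge of two `(1,0)`-forms with coefficient pairs `a = (a_1, a_2)`, `b = (b_1, b_2)`
against the frame `dz_1 ∧ dz_2`: `a_1 b_2 − a_2 b_1`. -/
def wedgeCoeff (a b : ℂ × ℂ) : ℂ := a.1 * b.2 - a.2 * b.1

/-- **The line interface** behind the cup product: the points of the four line quotients `[U(W_j)]`, the
identification `[T_i] = [U(W_{2i})] × [U(W_{2i+1})]`, the line integrals, the coefficient pairs of `(1,0)`-forms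
against the frame `(dz_1, dz_2)`, the characters `χ_j` of the lines and the line kernels — the theta forms
`φ^{(1,0)}` of the pairs `(U(W_j), U(V))` at `g ∈ [U(W_j)]`, as `(1,0)`-forms on `X`. -/
structure LineInterface (I : C7Face L) (D : DoublingInterface I) (K : KernelInterface I D) where
  /-- the points of `[U(W_j)]` -/
  LPt : Fin 4 → Type
  /-- `[T_i] = [U(W_{2i})] × [U(W_{2i+1})]` -/
  lineEquiv : (i : Fin 2) → K.TPt i ≃ (LPt (line i 0) × LPt (line i 1))
  /-- `∫_{[U(W_j)]} · dg` -/
  intL : (j : Fin 4) → (LPt j → ℂ) → ℂ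
  /-- the coefficient pair of a `(1,0)`-form on `X` -/
  coeff1 : D.Form → K.XPt → ℂ × ℂ
  /-- the character `χ_j` of the line `W_j` on `[U(W_j)]` -/
  lchar : I.Datum → (j : Fin 4) → LPt j → ℂ
  /-- the line kernel: the theta form `φ^{(1,0)}` of the pair `(U(W_j), U(V))` at `g`, a `(1,0)`-form on `X` -/
  lkernel : I.Datum → (j : Fin 4) → LPt j → K.XPt → ℂ × ℂ

/-- **The components of the cup product.**  The line lift as the character-weighted line integral of the line
kernel, componentwise; the wedge of two `(1,0)`-forms by its coefficient formula; the product character; the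
PRINTED identity — Bergeron 2006 Thm 1.1 p0003:L30–L33: the plane kernel at `(g_0, g_1)` is the wedge of the two
line kernels; the torus integral as the iterated line integral; linearity of the line integrals. -/
structure LineComponents (I : C7Face L) (D : DoublingInterface I) (K : KernelInterface I D)
    (N : LineInterface I D K) : Prop where
  /-- the line lift is the character-weighted line integral of the line kernel (both components) -/
  lineLift_def : ∀ (d : I.Datum) (j : Fin 4) (x : K.XPt),
    N.coeff1 (D.lineLift d j) x =
      (N.intL j (fun g => N.lchar d j g * (N.lkernel d j g x).1),
        N.intL j (fun g => N.lchar d j g * (N.lkernel d j g x).2))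
  /-- the coefficient of the wedge of two `(1,0)`-forms -/
  wedge_def : ∀ (f g : D.Form) (x : K.XPt), K.coeff (D.wedge f g) x = wedgeCoeff (N.coeff1 f x) (N.coeff1 g x)
  /-- the product character of the torus -/
  char_prod : ∀ (d : I.Datum) (i : Fin 2) (t : K.TPt i),
    K.char d i t = N.lchar d (line i 0) (N.lineEquiv i t).1 * N.lchar d (line i 1) (N.lineEquiv i t).2
  /-- PRINTED — Bergeron 2006 Thm 1.1: the plane kernel is the wedge of the two line kernels -/
  bergeron : ∀ (d : I.Datum) (i : Fin 2) (t : K.TPt i) (x : K.XPt),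
    K.kernel d i t x =
      wedgeCoeff (N.lkernel d (line i 0) (N.lineEquiv i t).1 x) (N.lkernel d (line i 1) (N.lineEquiv i t).2 x)
  /-- the torus integral is the iterated line integral -/
  intT_prod : ∀ (i : Fin 2) (F : N.LPt (line i 0) → N.LPt (line i 1) → ℂ),
    K.intT i (fun t => F (N.lineEquiv i t).1 (N.lineEquiv i t).2) =
      N.intL (line i 0) (fun g => N.intL (line i 1) (fun g' => F g g'))
  /-- the line integrals commute with scalars -/
  intL_smul : ∀ (j : Fin 4) (c : ℂ) (F : N.LPt j → ℂ), N.intL j (fun g => c * F g) = c * N.intL j F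
  /-- the line integrals are additive -/
  intL_sub : ∀ (j : Fin 4) (F G : N.LPt j → ℂ), N.intL j (fun g => F g - G g) = N.intL j F - N.intL j G

namespace LineComponents

variable {I : C7Face L} {D : DoublingInterface I} {K : KernelInterface I D} {N : LineInterface I D K}

/-- A product of two line integrals is the iterated integral of the product (from `intL_smul`). -/
theorem intL_mul_intL (H : LineComponents I D K N) (j j' : Fin 4) (F : N.LPt j → ℂ) (G : N.LPt j' → ℂ) :
    N.intL j F * N.intL j' G = N.intL j (fun g => N.intL j' (fun g' => F g * G g')) := by
  have h1 : ∀ g, N.intL j' (fun g' => F g * G g') = F g * N.intL j' G := fun g => H.intL_smul j' (F g) G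
  simp only [h1]
  rw [mul_comm, ← H.intL_smul j]
  congr 1
  funext g
  ring

/-- **(D2) at the level of coefficient functions**: the coefficient of `θ_{2i} ∧ θ_{2i+1}` is the coefficient of
the plane lift.  Proof: expand both line lifts, write the two products of line integrals as iterated integrals,
take the difference inside, recognise the product character and Bergeron's wedge of line kernels, and fold the
iterated integral back into the torus integral. -/
theorem cupProduct_coeff (H : LineComponents I D K N) (HK : KernelComponents I D K) (d : I.Datum) (i : Fin 2)
    (x : K.XPt) :
    K.coeff (D.wedge (D.lineLift d (line i 0)) (D.lineLift d (line i 1))) x = K.coeff (D.planeLift d i) x := by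
  rw [H.wedge_def, H.lineLift_def d (line i 0) x, H.lineLift_def d (line i 1) x, HK.planeLift_def d i x]
  unfold wedgeCoeff
  simp only
  rw [H.intL_mul_intL, H.intL_mul_intL, ← H.intL_sub]
  have h1 : (fun g => N.intL (line i 1) (fun g' =>
        N.lchar d (line i 0) g * (N.lkernel d (line i 0) g x).1 *
          (N.lchar d (line i 1) g' * (N.lkernel d (line i 1) g' x).2)) -
      N.intL (line i 1) (fun g' =>
        N.lchar d (line i 0) g * (N.lkernel d (line i 0) g x).2 *
          (N.lchar d (line i 1) g' * (N.lkernel d (line i 1) g' x).1))) =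
      fun g => N.intL (line i 1) (fun g' =>
        (N.lchar d (line i 0) g * N.lchar d (line i 1) g') *
          wedgeCoeff (N.lkernel d (line i 0) g x) (N.lkernel d (line i 1) g' x)) := by
    funext g
    rw [← H.intL_sub]
    congr 1
    funext g'
    unfold wedgeCoeff
    ring
  rw [h1, ← H.intT_prod i]
  congr 1
  funext t
  rw [H.char_prod d i t, H.bergeron d i t x]

/-- The Hodge pairing of the datum is the pairing of the two plane lifts, from (D1), (D0) and the coefficient-level
(D2) (the Hodge pairing only sees coefficient functions, `hodge_def`). -/
theorem hodgePairing_eq_planes_of_coeff (H : LineComponents I D K N) (HK : KernelComponents I D K)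
    (corner : CornerLifts I D) (forms : WitnessForms I D) (d : I.Datum) :
    I.hodgePairing d = D.hodge (D.planeLift d 0) (D.planeLift d 1) := by
  rw [forms d, corner d (line 0 0), corner d (line 0 1), corner d (line 1 0), corner d (line 1 1), HK.hodge_def,
    HK.hodge_def]
  congr 1
  funext x
  rw [H.cupProduct_coeff HK d 0 x, H.cupProduct_coeff HK d 1 x]

/-- **The doubling form of the identification from its kernel-level inputs**: (D0), (D1), Bergeron's identity
(through `LineComponents`), Harris's product formula and the integration rules (through `KernelComponents`),
the extended Siegel–Weil formula and the definitional match give `∀ d, hodgePairing d = torusPeriod d` — the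
field `Identification.doubling` — without the form-level (D2). -/
theorem doubling_of_kernel (H : LineComponents I D K N) (HK : KernelComponents I D K) (corner : CornerLifts I D)
    (forms : WitnessForms I D) (siegelWeil : SiegelWeil I D) (torusDef : TorusPeriodDef I D) :
    ∀ d : I.Datum, I.hodgePairing d = I.torusPeriod d := by
  intro d
  rw [H.hodgePairing_eq_planes_of_coeff HK corner forms d, HK.doublingIdentity d, torusDef d]
  congr 1
  funext t
  exact siegelWeil d t

/-- **The identification from its kernel-level inputs**: the doubling form from `doubling_of_kernel`, the
seesaw form from the seesaw components. -/
theorem identification_of_kernel (H : LineComponents I D K N) (HK : KernelComponents I D K)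
    (corner : CornerLifts I D) (forms : WitnessForms I D) (siegelWeil : SiegelWeil I D)
    (torusDef : TorusPeriodDef I D) (S : SpectralInterface I) (HS : SeesawComponents I S) : Identification I :=
  ⟨H.doubling_of_kernel HK corner forms siegelWeil torusDef, seesaw_of_components I S HS⟩

end LineComponents

end Summit.Ventures.HodgeRepro.PeriodCloser

end
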